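/-
Copyright: b2b-lace packet (CARVER gen 55).  [NoBLE17] §4.1.1 / Assumption 4.3 (4.43)–(4.45) and [FvdH17] §6.1 proof of
Lemma 5.1: the CRUDE `x`-space bounds of the `N ≤ 1` remainders `Ξ_R^{(N)}`, `Ψ_{R,I}^{(N),ι}`, `Ψ_{R,II}^{(N),ι}` of an
abstract NoBLE split — remainder ≤ coefficient (the `α`-parts are non-negative), and the single-direction `Ψ` bound
`Σ_x Ψ^{(N),κ}(x) ≤ (2d−1)/(2d)·(p/μ_p)·Σ_x Ξ^{(N)}(x)` from the landed `κ`-summed relation (`NobleRelationSummed`) and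
the landed exchangeability of the directions (`NobleSymmetry.noblePsiN_tsum_exch`).  Proofs only; no named fact; no
numeral; no dimension.
-/
import Literature.Probability.FitznerVanDerHofstad2017.NobleRemainderBound
import HarnessLib

/-!
# [NoBLE17] (4.43)–(4.45), crude form: `Ξ_R ≤ Ξ`, `Ψ_R ≤ Ψ`, and `Σ_x Ψ^{(N),κ}(x) ≤ (2d−1)/(2d)·(p/μ_p)·Σ_x Ξ^{(N)}(x)`

CITATION HEADER (PLACEMENT v2). This module is part of a certified REPRODUCTION of:
R. Fitzner, R. van der Hofstad, *Generalized approach to the non-backtracking lace expansion*, Probab. Theory Related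
Fields **169** (2017) 1041–1119 [NoBLE17], §4.1.1 (pp. 1080–1081: the split `Ξ^{(N)} = Ξ_α^{(N)} + Ξ_R^{(N)}`,
`Ψ^{(N),ι} = Ψ_{α,I}^{(N),ι} + Ψ_{R,I}^{(N),ι} = Ψ_{α,II}^{(N),ι} + Ψ_{R,II}^{(N),ι}` into "non-negative functions")
and Assumption 4.3 (4.43)–(4.45) (p. 1087: the bounds `Σ_x Ξ_R^{(N)}(x) ≤ β^{(N)}_{Ξ,R}`, `Σ_x Ψ_{R,·}^{(N),ι}(x) ≤
β^{(N)}_{Ψ,R,·}` the analysis consumes), Assumption 4.1 (4.28) (p. 1085: exchangeability of the directions); and of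
R. Fitzner, R. van der Hofstad, *Mean-field behavior for nearest-neighbor percolation in `d > 10`*, Electron. J.
Probab. **22** (2017) no. 43 [FvdH17] (arXiv:1506.07977v2), §6.1 proof of Lemma 5.1 (v2 p. 60: "The argument […] also
implies that `Σ_κ Ψ^{(N),κ}_p(x) ≤ (2d−1)(p/μ_p) Ξ^{(N)}_p(x)`. Combining this with the bound (5.x) gives
`Σ_x Ψ_{R,I}^{(1),κ}(x) ≤ (p/μ_p)(2d−1)/(2d) P⃗^S Ā^ι P⃗^E`"; and display (Psi-R-x) `Ψ_{R,I}^{(1),κ}(x) ≤ Ψ^{(N),κ}(x) ≤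
(p/μ_p) Ξ^{(N)}(x)`).  Origin: build `lace` (host summit CriticalPhenomena), CARVER seat; node N76-E3CRUDE (leaf L5.1 +
the crude halves of L5.3/L5.4 of the REV15 precondition census, Row E3).

WHAT THIS FILE DOES (all `d`-generic, for an ABSTRACT split `S : NobleSplit d p`).  (A) `xiR ≤ Ξ`, `psiRI ≤ Ψ`,
`psiRII ≤ Ψ` pointwise (`sub_le_self` with the split's `_nonneg` fields) and the transfer of a genuine `x`-sum bound
(`SumLE`: summable + `tsum ≤`) from the coefficient to the remainder (domination of non-negative functions).  (B) The
single-direction `Ψ` bound: by exchangeability (`noblePsiN_tsum_exch`) `Σ_x Ψ^{(N),κ}(x) = (1/2d) Σ_{κ'} Σ_x Ψ^{(N),κ'}(x)`,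
the finite `κ'`-sum commutes with the `x`-sum (every `Ψ^{(N),κ'}` is summable: `0 ≤ Ψ ≤ (p/μ_p) Ξ`, `noblePsiN_le`), and
the landed `κ`-summed relation (`nobleRelationSummedAt_of_lt_criticalProbI`, `2 ≤ d`, `0 < p < p_c`) gives
`Σ_x Ψ^{(N),κ}(x) ≤ (2d−1)/(2d)·(p/μ_p)·B` for any genuine `Σ_x Ξ^{(N)}(x) ≤ B`.  (C) The compositions: the field
shapes `SumLE (S.xiR N) B`, `SumLE (S.psiRI N ι) ((2d−1)/(2d)·(p/μ_p)·B)`, `SumLE (S.psiRII N ι) (…)` of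
`NobleInputValid` ((4.43)–(4.45), `N ≤ 1`) from ONE genuine bound `SumLE (nobleXiN d p N) B`.  (D) The same from
the `ℝ≥0∞` currency the `x`-space producers land (`Σ_x ofReal Ξ^{(N)}_p(x) ≤ ofReal B`, e.g. [FvdH17] (6.5) at
`N = 1`: `P⃗^S Ā P⃗^E` evaluated), packaged as one triple.

These are the CRUDE producers: the printed bounds of [FvdH17] Lemma 5.1 for `N = 1` improve them by the
"(0,0)-square device" (`−(Ā^ι)_{0,0} + Σ 𝓣_{1̲,1,2}`, v2 p. 60), which is NOT typed here; whether the crude values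
close the final conditions is a numerical question outside this module.  Nothing landed is modified; no cited
hypothesis — every statement is a kernel-proved inequality between landed definitions.
-/

noncomputable section

namespace Literature.Probability.FitznerVanDerHofstad2017

open MeasureTheory Finset
open scoped BigOperators ENNReal
open Literature.Probability.LatticeModels Literature.Probability.Percolation
open Literature.Barriers.CriticalPhenomena

variable {d : ℕ} {p : unitInterval}

/-! ## A. Remainder ≤ coefficient, and the `SumLE` transfer -/

namespace NobleSplit

variable (S : NobleSplit d p)

/-- `Ξ_R^{(N)}(x) ≤ Ξ^{(N)}(x)` (`N ≤ 1`; `Ξ_α ≥ 0`). [cite: FitznerVanDerHofstad2016NoBLE, §4.1.1 ("non-negative functions", pp. 1080–1081)] -/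
theorem xiR_le_nobleXiN {N : ℕ} (hN : N ≤ 1) (x : Site d) : S.xiR N x ≤ nobleXiN d p N x :=
  sub_le_self _ (S.xiA_nonneg N hN x)

/-- `0 ≤ Ψ_{R,I}^{(N),ι}(x)` (`N ≤ 1`) — a private copy of `NobleSplit.psiRI_nonneg` (`NobleKSpaceRewriteFRem`, not imported
here to keep this module's import cone at `NobleRemainderBound`). [cite: FitznerVanDerHofstad2016NoBLE, §4.1.1 ("non-negative functions", pp. 1080–1081)] -/
private theorem psiRI_nonneg_crude {N : ℕ} (hN : N ≤ 1) (ι : Fin d × Bool) (x : Site d) : 0 ≤ S.psiRI N ι x :=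
  sub_nonneg.2 (S.psiAI_le N hN ι x)

/-- `Ψ_{R,I}^{(N),ι}(x) ≤ Ψ^{(N),ι}(x)` (`N ≤ 1`; `Ψ_{α,I} ≥ 0`) — [FvdH17] display (Psi-R-x), first inequality.
[cite: FitznerVanDerHofstad2016NoBLE, §4.1.1 (pp. 1080–1081)] [cite: FitznerVanDerHofstad2017, §6.1 proof of Lemma 5.1, display before (lemmapercboundXi1-7-step2) (arXiv:1506.07977v2 p. 60)] -/
theorem psiRI_le_noblePsiN {N : ℕ} (hN : N ≤ 1) (ι : Fin d × Bool) (x : Site d) :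
    S.psiRI N ι x ≤ noblePsiN d p (stepVec ι) N x :=
  sub_le_self _ (S.psiAI_nonneg N hN ι x)

/-- `0 ≤ Ψ_{R,II}^{(N),ι}(x)` (`N ≤ 1`) — a private copy of `NobleSplit.psiRII_nonneg` (`NobleKSpaceRewriteFRem`). [cite: FitznerVanDerHofstad2016NoBLE, §4.1.1 ("non-negative functions", pp. 1080–1081)] -/
private theorem psiRII_nonneg_crude {N : ℕ} (hN : N ≤ 1) (ι : Fin d × Bool) (x : Site d) : 0 ≤ S.psiRII N ι x :=
  sub_nonneg.2 (S.psiAII_le N hN ι x)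

/-- `Ψ_{R,II}^{(N),ι}(x) ≤ Ψ^{(N),ι}(x)` (`N ≤ 1`; `Ψ_{α,II} ≥ 0`). [cite: FitznerVanDerHofstad2016NoBLE, §4.1.1 (pp. 1080–1081)] -/
theorem psiRII_le_noblePsiN {N : ℕ} (hN : N ≤ 1) (ι : Fin d × Bool) (x : Site d) :
    S.psiRII N ι x ≤ noblePsiN d p (stepVec ι) N x :=
  sub_le_self _ (S.psiAII_nonneg N hN ι x)

end NobleSplit

/-- `SumLE` (summable + `tsum ≤`) passes from a majorant to a non-negative minorant (domination of non-negative
functions). [cite: FitznerVanDerHofstad2016NoBLE, Assumption 4.3 (p. 1086: "we assume that Σ_N β^{(N)} < ∞" — the genuine-sum reading)] -/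
theorem sumLE_of_nonneg_of_le {f g : Site d → ℝ} {B : ℝ} (hg : SumLE g B) (h0 : ∀ x, 0 ≤ f x)
    (hle : ∀ x, f x ≤ g x) : SumLE f B :=
  ⟨hg.1.of_nonneg_of_le h0 hle, ((hg.1.of_nonneg_of_le h0 hle).tsum_le_tsum hle hg.1).trans hg.2⟩

namespace NobleSplit

variable (S : NobleSplit d p)

/-- **(4.43) crude**: `Σ_x Ξ^{(N)}(x) ≤ B ⟹ Σ_x Ξ_R^{(N)}(x) ≤ B` as genuine sums (`N ≤ 1`).
[cite: FitznerVanDerHofstad2016NoBLE, §4.1.1 and Assumption 4.3 (4.43) (pp. 1080–1081, 1087)] -/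
theorem sumLE_xiR_of_sumLE_nobleXiN {N : ℕ} (hN : N ≤ 1) {B : ℝ} (h : SumLE (nobleXiN d p N) B) :
    SumLE (S.xiR N) B :=
  sumLE_of_nonneg_of_le h (S.xiR_nonneg hN) (S.xiR_le_nobleXiN hN)

/-- **(4.44) crude, from a `Ψ` bound**: `Σ_x Ψ^{(N),ι}(x) ≤ B ⟹ Σ_x Ψ_{R,I}^{(N),ι}(x) ≤ B` (`N ≤ 1`).
[cite: FitznerVanDerHofstad2016NoBLE, §4.1.1 and Assumption 4.3 (4.44) (pp. 1080–1081, 1087)] -/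
theorem sumLE_psiRI_of_sumLE_noblePsiN {N : ℕ} (hN : N ≤ 1) (ι : Fin d × Bool) {B : ℝ}
    (h : SumLE (noblePsiN d p (stepVec ι) N) B) : SumLE (S.psiRI N ι) B :=
  sumLE_of_nonneg_of_le h (S.psiRI_nonneg_crude hN ι) (S.psiRI_le_noblePsiN hN ι)

/-- **(4.45) crude, from a `Ψ` bound**: `Σ_x Ψ^{(N),ι}(x) ≤ B ⟹ Σ_x Ψ_{R,II}^{(N),ι}(x) ≤ B` (`N ≤ 1`).
[cite: FitznerVanDerHofstad2016NoBLE, §4.1.1 and Assumption 4.3 (4.45) (pp. 1080–1081, 1087)] -/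
theorem sumLE_psiRII_of_sumLE_noblePsiN {N : ℕ} (hN : N ≤ 1) (ι : Fin d × Bool) {B : ℝ}
    (h : SumLE (noblePsiN d p (stepVec ι) N) B) : SumLE (S.psiRII N ι) B :=
  sumLE_of_nonneg_of_le h (S.psiRII_nonneg_crude hN ι) (S.psiRII_le_noblePsiN hN ι)

end NobleSplit

/-! ## B. One direction of `Ψ`: `Σ_x Ψ^{(N),κ}(x) ≤ (2d−1)/(2d)·(p/μ_p)·Σ_x Ξ^{(N)}(x)` -/

/-- `Ψ^{(N),κ} ≥ 0` is summable whenever `Ξ^{(N)}` is (`Ψ ≤ (p/μ_p) Ξ`, `noblePsiN_le`; `p < p_c`, `2 ≤ d`).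
[cite: FitznerVanDerHofstad2017, §3.5 (3.74) (arXiv:1506.07977v2)] -/
theorem summable_noblePsiN_of_summable_nobleXiN (hd : 2 ≤ d) (hp : p < criticalProbI d)
    {N : ℕ} (h : Summable (nobleXiN d p N)) (κ : Fin d × Bool) : Summable (noblePsiN d p (stepVec κ) N) := by
  have hμ : 0 ≤ (p : ℝ) / nobleMu d p := div_nonneg p.2.1 (nobleMu_nonneg d p)
  refine (h.mul_left ((p : ℝ) / nobleMu d p)).of_nonneg_of_le (fun x => noblePsiN_nonneg' p _ N x) fun x => ?_
  exact noblePsiN_le p (stepVec κ) N x hμ (nobleXiT_ne_top hd hp N x)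

/-- **`Σ_x Ψ^{(N),κ}(x) ≤ (2d−1)/(2d)·(p/μ_p)·B`** for every direction `κ`, from a genuine `Σ_x Ξ^{(N)}(x) ≤ B`
(`2 ≤ d`, `0 < p < p_c`): exchangeability of the directions, the finite `κ`-sum through the `x`-sum, and the landed
`κ`-summed relation `Σ_κ Ψ^{(N),κ}(x) ≤ (2d−1)(p/μ_p) Ξ^{(N)}(x)`.
[cite: FitznerVanDerHofstad2017, §6.1 proof of Lemma 5.1, (lemmapercboundXi1-5-step1) and the display above it (arXiv:1506.07977v2 p. 60)]
[cite: FitznerVanDerHofstad2016NoBLE, Assumption 4.1 (4.28) (p. 1085); Assumption 4.2 (pp. 1085–1086)] -/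
theorem sumLE_noblePsiN_of_sumLE_nobleXiN (hd : 2 ≤ d) (hp0 : 0 < (p : ℝ)) (hp : p < criticalProbI d) {N : ℕ}
    {B : ℝ} (h : SumLE (nobleXiN d p N) B) (κ : Fin d × Bool) :
    SumLE (noblePsiN d p (stepVec κ) N) ((2 * d - 1) / (2 * d) * ((p : ℝ) / nobleMu d p) * B) := by
  have hsum : ∀ κ', Summable (noblePsiN d p (stepVec κ') N) :=
    summable_noblePsiN_of_summable_nobleXiN hd hp h.1
  have hrel := (nobleRelationSummedAt_of_lt_criticalProbI hd hp0 hp).1 N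
  have hμ : 0 ≤ (p : ℝ) / nobleMu d p := div_nonneg p.2.1 (nobleMu_nonneg d p)
  have hd0 : (0 : ℝ) < 2 * d := by
    have : (2 : ℝ) ≤ d := by exact_mod_cast hd
    linarith
  have hc : (0 : ℝ) ≤ 2 * d - 1 := by
    have : (2 : ℝ) ≤ d := by exact_mod_cast hd
    linarith
  refine ⟨hsum κ, ?_⟩
  -- `2d · Σ_x Ψ^κ = Σ_{κ'} Σ_x Ψ^{κ'} = Σ_x Σ_{κ'} Ψ^{κ'} ≤ (2d−1)(p/μ) Σ_x Ξ`
  have hcard : (Finset.univ : Finset (Fin d × Bool)).card = 2 * d := by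
    rw [Finset.card_univ, Fintype.card_prod, Fintype.card_fin, Fintype.card_bool]; ring
  have h1 : (2 * d : ℝ) * ∑' x, noblePsiN d p (stepVec κ) N x = ∑ κ' : Fin d × Bool, ∑' x, noblePsiN d p (stepVec κ') N x := by
    rw [Finset.sum_congr rfl fun κ' _ => noblePsiN_tsum_exch (p := p) N κ' κ, Finset.sum_const, hcard,
      nsmul_eq_mul]
    push_cast
    ring
  have h2 : ∑ κ' : Fin d × Bool, ∑' x, noblePsiN d p (stepVec κ') N x = ∑' x, ∑ κ' : Fin d × Bool, noblePsiN d p (stepVec κ') N x :=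
    (Summable.tsum_finsetSum (fun κ' _ => hsum κ')).symm
  have h3 : ∑' x, ∑ κ' : Fin d × Bool, noblePsiN d p (stepVec κ') N x ≤
      ∑' x, (2 * d - 1) * ((p : ℝ) / nobleMu d p) * nobleXiN d p N x :=
    (summable_sum fun κ' _ => hsum κ').tsum_le_tsum hrel (h.1.mul_left _)
  have h4 : ∑' x, (2 * d - 1) * ((p : ℝ) / nobleMu d p) * nobleXiN d p N x ≤
      (2 * d - 1) * ((p : ℝ) / nobleMu d p) * B := by
    rw [tsum_mul_left]
    exact mul_le_mul_of_nonneg_left h.2 (mul_nonneg hc hμ)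
  have key : (2 * d : ℝ) * ∑' x, noblePsiN d p (stepVec κ) N x ≤ (2 * d - 1) * ((p : ℝ) / nobleMu d p) * B := by
    rw [h1, h2]; exact h3.trans h4
  rw [div_mul_eq_mul_div, div_mul_eq_mul_div, le_div_iff₀ hd0]
  calc (∑' x, noblePsiN d p (stepVec κ) N x) * (2 * d) = (2 * d : ℝ) * ∑' x, noblePsiN d p (stepVec κ) N x := by ring
    _ ≤ (2 * d - 1) * ((p : ℝ) / nobleMu d p) * B := key

/-! ## C. The field shapes (4.44)–(4.45) from ONE genuine `Σ_x Ξ^{(N)}(x) ≤ B` -/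

namespace NobleSplit

variable (S : NobleSplit d p)

/-- **(4.44) crude**: `Σ_x Ψ_{R,I}^{(N),ι}(x) ≤ (2d−1)/(2d)·(p/μ_p)·B` from `Σ_x Ξ^{(N)}(x) ≤ B` (`N ≤ 1`, `2 ≤ d`,
`0 < p < p_c`) — [FvdH17] (lemmapercboundXi1-5-step1) without the printed `(0,0)`-entry replacement.
[cite: FitznerVanDerHofstad2017, §6.1 proof of Lemma 5.1 (arXiv:1506.07977v2 p. 60)] [cite: FitznerVanDerHofstad2016NoBLE, Assumption 4.3 (4.44) (p. 1087)] -/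
theorem sumLE_psiRI_of_sumLE_nobleXiN (hd : 2 ≤ d) (hp0 : 0 < (p : ℝ)) (hp : p < criticalProbI d) {N : ℕ}
    (hN : N ≤ 1) {B : ℝ} (h : SumLE (nobleXiN d p N) B) (ι : Fin d × Bool) :
    SumLE (S.psiRI N ι) ((2 * d - 1) / (2 * d) * ((p : ℝ) / nobleMu d p) * B) :=
  S.sumLE_psiRI_of_sumLE_noblePsiN hN ι (sumLE_noblePsiN_of_sumLE_nobleXiN hd hp0 hp h ι)

/-- **(4.45) crude**: `Σ_x Ψ_{R,II}^{(N),ι}(x) ≤ (2d−1)/(2d)·(p/μ_p)·B` from `Σ_x Ξ^{(N)}(x) ≤ B` (`N ≤ 1`, `2 ≤ d`,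
`0 < p < p_c`) — the printed (lemmapercboundXi1-6-step1) route goes through `Ξ_R^{(1)}` instead and is sharper by the
"(0,0)-square device"; not typed here.
[cite: FitznerVanDerHofstad2017, §6.1 proof of Lemma 5.1 (arXiv:1506.07977v2 p. 60)] [cite: FitznerVanDerHofstad2016NoBLE, Assumption 4.3 (4.45) (p. 1087)] -/
theorem sumLE_psiRII_of_sumLE_nobleXiN (hd : 2 ≤ d) (hp0 : 0 < (p : ℝ)) (hp : p < criticalProbI d) {N : ℕ}
    (hN : N ≤ 1) {B : ℝ} (h : SumLE (nobleXiN d p N) B) (ι : Fin d × Bool) :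
    SumLE (S.psiRII N ι) ((2 * d - 1) / (2 * d) * ((p : ℝ) / nobleMu d p) * B) :=
  S.sumLE_psiRII_of_sumLE_noblePsiN hN ι (sumLE_noblePsiN_of_sumLE_nobleXiN hd hp0 hp h ι)

end NobleSplit

/-! ## D. From the block-product currency: `Σ_x ofReal Ξ^{(N)}(x) ≤ ofReal B` (the shape the `x`-space producers land) -/

/-- A genuine real `x`-sum bound from an `ℝ≥0∞` one: `Σ_x ofReal (g x) ≤ ofReal B`, `g ≥ 0`, `B ≥ 0` ⟹ `SumLE g B`.
[cite: FitznerVanDerHofstad2016NoBLE, Assumption 4.3 (p. 1086: the genuine-sum reading "Σ_N β^{(N)} < ∞")] -/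
theorem sumLE_of_tsum_ofReal_le {g : Site d → ℝ} (hg : ∀ x, 0 ≤ g x) {B : ℝ} (hB : 0 ≤ B)
    (h : ∑' x, ENNReal.ofReal (g x) ≤ ENNReal.ofReal B) : SumLE g B := by
  have hne : ∑' x, ENNReal.ofReal (g x) ≠ ∞ := ne_top_of_le_ne_top ENNReal.ofReal_ne_top h
  have hs : Summable g := (ENNReal.summable_toReal hne).congr fun x => ENNReal.toReal_ofReal (hg x)
  refine ⟨hs, ?_⟩
  have h' := ENNReal.toReal_mono ENNReal.ofReal_ne_top h
  rwa [← ENNReal.ofReal_tsum_of_nonneg hg hs, ENNReal.toReal_ofReal (tsum_nonneg hg), ENNReal.toReal_ofReal hB] at h'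

/-- `Σ_x ofReal Ξ^{(N)}(x) ≤ ofReal B ⟹ SumLE Ξ^{(N)} B` (`B ≥ 0`). [cite: FitznerVanDerHofstad2016NoBLE, Assumption 4.3 (4.31) (p. 1086)] -/
theorem sumLE_nobleXiN_of_tsum_ofReal_le (p : unitInterval) {N : ℕ} {B : ℝ} (hB : 0 ≤ B)
    (h : ∑' x, ENNReal.ofReal (nobleXiN d p N x) ≤ ENNReal.ofReal B) : SumLE (nobleXiN d p N) B :=
  sumLE_of_tsum_ofReal_le (nobleXiN_nonneg p N) hB h

namespace NobleSplit

variable (S : NobleSplit d p)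

/-- **(4.43)–(4.45) crude, packaged**: from ONE `x`-space bound `Σ_x ofReal Ξ^{(N)}_p(x) ≤ ofReal B` (`B ≥ 0`,
`N ≤ 1`, `2 ≤ d`, `0 < p < p_c`) the three remainder rows `Σ_x Ξ_R^{(N)} ≤ B`, `Σ_x Ψ_{R,I}^{(N),ι} ≤
(2d−1)/(2d)(p/μ_p) B`, `Σ_x Ψ_{R,II}^{(N),ι} ≤ (2d−1)/(2d)(p/μ_p) B` (every `ι`), as genuine sums.
[cite: FitznerVanDerHofstad2016NoBLE, Assumption 4.3 (4.43)–(4.45) (p. 1087)] [cite: FitznerVanDerHofstad2017, §6.1 proof of Lemma 5.1 (arXiv:1506.07977v2 p. 60)] -/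
theorem sumLE_remainders_crude_of_tsum_ofReal_le (hd : 2 ≤ d) (hp0 : 0 < (p : ℝ)) (hp : p < criticalProbI d)
    {N : ℕ} (hN : N ≤ 1) {B : ℝ} (hB : 0 ≤ B) (h : ∑' x, ENNReal.ofReal (nobleXiN d p N x) ≤ ENNReal.ofReal B) :
    SumLE (S.xiR N) B ∧
      (∀ ι, SumLE (S.psiRI N ι) ((2 * d - 1) / (2 * d) * ((p : ℝ) / nobleMu d p) * B)) ∧
        ∀ ι, SumLE (S.psiRII N ι) ((2 * d - 1) / (2 * d) * ((p : ℝ) / nobleMu d p) * B) :=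
  have hX := sumLE_nobleXiN_of_tsum_ofReal_le p hB h
  ⟨S.sumLE_xiR_of_sumLE_nobleXiN hN hX, fun ι => S.sumLE_psiRI_of_sumLE_nobleXiN hd hp0 hp hN hX ι,
    fun ι => S.sumLE_psiRII_of_sumLE_nobleXiN hd hp0 hp hN hX ι⟩

end NobleSplit

end Literature.Probability.FitznerVanDerHofstad2017

end
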